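import Mathlib
import HarnessLib
import Summits.Ventures.LatticeQCDFlow.Exactness.SUNEngineResidualLayerEquivariance
import Summits.Ventures.LatticeQCDFlow.Exactness.InversePassJacobian

/-!
# The INVERSE pass of the engine's general residual coupling layer is exact, with a continuous positive class-function Jacobian `1/(j ∘ Ψ⁻¹)` — every `N`

HONEST FRAMING: exact (Metropolis-corrected) sampling algorithms for lattice gauge theory;
figures of merit are autocorrelation/cost numbers at stated couplings and volumes; no
continuum-physics claim.

Venture `LatticeQCDFlow` (cell pub-lqcd), topic `Exactness`; FANOUT row 10 (`eng-equiv`; engine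
`equiv/residual.py` `ResidualCoupling.inverse` — certified fixed-point inversion under the guard
`Σ_j Σ_k (1+k)|a_{j,k}| < 1`, booking `−logJ` — for the stout-defect / plaquette-potential layers).
NEW WORK of the cell: the twin, for the engine's general residual coupling layer, of
`SUNStoutLayerInversePass` (the stout case; independent of it), over `SUNResidualCouplingLayer`
(`isHomeomorph_engineResidualCouplingLayer`), `SUNEngineResidualLayerEquivariance` (equivariance and
class-function Jacobians of the layer), `InversePassJacobian.HasJacobian.symm_ofReal` and
`EquivariantJacobianGaugeInvariance.isGaugeInvariant_jac_comp_symm`.  Nothing is cited as a fact; no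
number; no definition.

* **`inversePass_engineResidualCouplingLayer`** — every `N`, `d`, `L`, mask, degree `K`, unitary staples
  based at the source of the active link and continuous in the frozen links, continuous gauge-invariant
  coefficients with the certificate: for the layer presented as `Ψ : GaugeConfig ≃ᵐ GaugeConfig` and ANY
  continuous exact Jacobian `j > 0` of it, the inverse layer `Ψ⁻¹` is exact for product Haar with
  Jacobian `U ↦ 1/j(Ψ⁻¹ U)`, continuous, positive and gauge invariant.
-/

noncomputable section

namespace Summit.Ventures.LatticeQCDFlow.Exactness

open Literature.MathematicalPhysics.QuantumFieldTheory
open Literature.MathematicalPhysics.QuantumFieldTheory.Luscher2010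
open MeasureTheory
open scoped Matrix ENNReal

variable {d L n : ℕ} [NeZero L] {σ : Type*} [Fintype σ]

/-- **The inverse pass of the engine's residual coupling layer is exact with a continuous positive
class-function Jacobian.** -/
theorem inversePass_engineResidualCouplingLayer (p : Edge d L → Prop) [DecidablePred p] (K : ℕ)
    (C : {e : Edge d L // p e} → σ → ({f : Edge d L // ¬p f} → Matrix.specialUnitaryGroup (Fin n) ℂ) →
      Matrix (Fin n) (Fin n) ℂ)
    (hCu : ∀ a j y, C a j y ∈ Matrix.unitaryGroup (Fin n) ℂ) (hCc : ∀ a j, Continuous (C a j))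
    (acoef : {e : Edge d L // p e} → σ → ℕ → ({f : Edge d L // ¬p f} → Matrix.specialUnitaryGroup (Fin n) ℂ) → ℝ)
    (hac : ∀ a j k, Continuous (acoef a j k))
    (hκ : ∀ a y, ∑ j, ∑ k ∈ Finset.range K, (1 + (k : ℝ)) * |acoef a j k y| < 1)
    (hCg : ∀ (g : Site d L → Matrix.specialUnitaryGroup (Fin n) ℂ)
      (V : GaugeConfig d L (Matrix.specialUnitaryGroup (Fin n) ℂ)) (a : {e : Edge d L // p e}) (j : σ),
      C a j (fun f => gaugeTransform g V f) =
        ((g (a.1.1.shift a.1.2) : Matrix.specialUnitaryGroup (Fin n) ℂ) : Matrix (Fin n) (Fin n) ℂ) *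
          C a j (fun f => V f) * star ((g a.1.1 : Matrix.specialUnitaryGroup (Fin n) ℂ) : Matrix (Fin n) (Fin n) ℂ))
    (hag : ∀ (g : Site d L → Matrix.specialUnitaryGroup (Fin n) ℂ)
      (V : GaugeConfig d L (Matrix.specialUnitaryGroup (Fin n) ℂ)) (a : {e : Edge d L // p e}) (j : σ) (k : ℕ),
      acoef a j k (fun f => gaugeTransform g V f) = acoef a j k (fun f => V f))
    (Ψ : GaugeConfig d L (Matrix.specialUnitaryGroup (Fin n) ℂ) ≃ᵐ GaugeConfig d L (Matrix.specialUnitaryGroup (Fin n) ℂ))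
    (hΨ : ⇑Ψ = Theory2.coupleFun p fun a y (u : Matrix.specialUnitaryGroup (Fin n) ℂ) =>
      (⟨NormedSpace.exp (∑ j, ((∑ k ∈ Finset.range K, acoef a j k y *
            (((u : Matrix (Fin n) (Fin n) ℂ) * C a j y).trace.re / n) ^ k : ℝ) : ℂ) •
          (-suProj ((u : Matrix (Fin n) (Fin n) ℂ) * C a j y))) * u,
        residual_value_mem (fun U _ => residualExponent_skew (fun j k => acoef a j k y) K
          (fun j => C a j y) U) u.2⟩ : Matrix.specialUnitaryGroup (Fin n) ℂ))
    {j : GaugeConfig d L (Matrix.specialUnitaryGroup (Fin n) ℂ) → ℝ} (hj : Continuous j) (hj0 : ∀ U, 0 < j U)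
    (h : HasJacobian (Measure.pi fun _ : Edge d L => haarProbability (Matrix.specialUnitaryGroup (Fin n) ℂ)) Ψ
      (fun U => ENNReal.ofReal (j U))) :
    HasJacobian (Measure.pi fun _ : Edge d L => haarProbability (Matrix.specialUnitaryGroup (Fin n) ℂ)) Ψ.symm
        (fun U => ENNReal.ofReal (j (Ψ.symm U))⁻¹) ∧
      Continuous (fun U => (j (Ψ.symm U))⁻¹) ∧ (∀ U, 0 < (j (Ψ.symm U))⁻¹) ∧
      IsGaugeInvariant (fun U => (j (Ψ.symm U))⁻¹) := by
  have hhom : IsHomeomorph (Ψ : GaugeConfig d L (Matrix.specialUnitaryGroup (Fin n) ℂ) →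
      GaugeConfig d L (Matrix.specialUnitaryGroup (Fin n) ℂ)) := by
    rw [hΨ]
    exact isHomeomorph_engineResidualCouplingLayer (p := p) K C hCu hCc acoef hac hκ
  -- the inverse map of `Ψ` is the homeomorphism's inverse (inverse uniqueness), hence continuous
  have hsymm : Continuous (Ψ.symm : GaugeConfig d L (Matrix.specialUnitaryGroup (Fin n) ℂ) →
      GaugeConfig d L (Matrix.specialUnitaryGroup (Fin n) ℂ)) := by
    have heq : (Ψ.symm : GaugeConfig d L (Matrix.specialUnitaryGroup (Fin n) ℂ) →
        GaugeConfig d L (Matrix.specialUnitaryGroup (Fin n) ℂ)) = (hhom.homeomorph (Ψ : _ → _)).symm := by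
      funext x
      apply Ψ.injective
      rw [Ψ.apply_symm_apply]
      exact ((hhom.homeomorph (Ψ : _ → _)).apply_symm_apply x).symm
    rw [heq]
    exact (hhom.homeomorph (Ψ : _ → _)).symm.continuous
  have hΦ : HasJacobian (Measure.pi fun _ : Edge d L => haarProbability (Matrix.specialUnitaryGroup (Fin n) ℂ))
      (Theory2.coupleFun p fun a y (u : Matrix.specialUnitaryGroup (Fin n) ℂ) =>
        (⟨NormedSpace.exp (∑ j, ((∑ k ∈ Finset.range K, acoef a j k y *
              (((u : Matrix (Fin n) (Fin n) ℂ) * C a j y).trace.re / n) ^ k : ℝ) : ℂ) •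
            (-suProj ((u : Matrix (Fin n) (Fin n) ℂ) * C a j y))) * u,
          residual_value_mem (fun U _ => residualExponent_skew (fun j k => acoef a j k y) K
            (fun j => C a j y) U) u.2⟩ : Matrix.specialUnitaryGroup (Fin n) ℂ))
      (fun U => ENNReal.ofReal (j U)) := by
    rw [← hΨ]
    exact h
  have hjinv : IsGaugeInvariant j :=
    isGaugeInvariant_jacobian_engineResidualCouplingLayer p K C hCu hCc acoef hac hκ hCg hag hj
      (fun U => (hj0 U).le) hΦ
  have hequiv : IsGaugeEquivariant (Ψ : GaugeConfig d L (Matrix.specialUnitaryGroup (Fin n) ℂ) →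
      GaugeConfig d L (Matrix.specialUnitaryGroup (Fin n) ℂ)) := by
    rw [hΨ]
    exact isGaugeEquivariant_engineResidualCouplingLayer p K C acoef hCg hag
  refine ⟨h.symm_ofReal hj0, (hj.comp hsymm).inv₀ fun U => (hj0 _).ne', fun U => inv_pos.mpr (hj0 _), ?_⟩
  have hcomp : IsGaugeInvariant fun U => j (Ψ.symm U) := isGaugeInvariant_jac_comp_symm hequiv hjinv
  intro g U
  simp only [hcomp g U]

end Summit.Ventures.LatticeQCDFlow.Exactness

end
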